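import Mathlib
import Literature.MathematicalPhysics.MHD.ScrewPinchStability
import HarnessLib

/-!
# F3.r4 instance «RwmFRS1Kq08»: the PLASMA EQUILIBRIUM of MODEL M_RWM,8 — the `q₀ = 4/5` member of the exact force-balanced
# screw-pinch family (`B_z ≡ 1`, `B_θ = r/(4(1+r²))`, force-balance pressure), typed as a `ScrewPinch.Profile`

LADDER-GRIDFUSION rung F3, row F3.r4 of `models/F3-SCOPING.md` (writer gridfusion-model-6, g8).  A CONSTRUCTION, not a printed
equilibrium: the same closed-form family as `Models/TearingFRS1EqIdealSigmaBoundR5.lean` (`EqSigmaR5.hl5`, `q₀ = 7/5`) and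
`Models/KinkEqScrewPinchQ07.lean` (`KinkEqQ07.hlK`, `q₀ = 7/10`): `B_z ≡ 1`, `B_θ = r c/(1 + r²)`, pressure FROM RADIAL FORCE
BALANCE `p = c²/(2(1+r²)²) − c²/8 + c²/400`, `μ₀ = 1`, plasma radius `a = 1`, `c = 1/(R₀q₀)`, here with `q(r) = q₀(1 + r²)`,
`q₀ = 4/5` (`R₀ = 5a`, so `c = 1/4`): `q_a = 8/5 < 2`, the external `(2,1)` kink configuration one step closer to `q_a = 2` than the
`q₀ = 7/10` member of row #109.  Print anchor for the family's `q`-SHAPE only: HamEtAl2013 §4 `q = q₀(1 + λr²/r_a²)`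
[cite: HamEtAl2013, §4] has `q₀ = 1.4`; the value `q₀ = 4/5` here is a MODEL CHOICE (SYNTHETIC), said so in every sentence.
«MODELLED: straight cylinder, ideal MHD, single helicity; absent: toroidicity (`R₀` only through `k`), resistivity in the plasma,
rotation; MODEL-VALIDITY: MV-7R family strings; NOT a statement about any device.»

CONTENTS (all [instance data], proved): `u8`, `p8`, `P8` (the `ScrewPinch.Profile`), `P8_μ₀`, `P8_Bz`, `P8_Bθ`, `P8_p`, `q_eq`
(`q = (4/5)(1 + r²)`), `p8_pos` (`p > 0` on `[0, 1]`), `central_beta` (`β₀ = 151/3200`), `hasDerivAt_p` / `deriv_p` / `contDiff_p`,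
**`isRadialPressureBalance`** (the tree predicate `ScrewPinch.Profile.IsRadialPressureBalance` on `(0,1)`: EXACT EQUILIBRIUM
[cite: Schnack2009, Lect. 30 eq. (30.30)]), `contDiff_Bθ`, `profile_regular`.  NO certificate here: this file is the by-name
base of `RwmFRS1Kq08.lean` (Newcomb's `f`, `g`, the marginal equation) and its companions. [instance data]
-/

noncomputable section

open Set Literature.MathematicalPhysics.MHD

namespace Summit.Ventures.FusionMHD.Models

namespace RwmFRS1

namespace Kq08

/-! ### The model: the force-balanced `q₀ = 4/5` screw pinch -/

/-- `u(r) = c/(1 + r²)` with `c = 1/(R₀q₀) = 1/4` (`R₀ = 5`, `q₀ = 4/5`); `B_θ = r u`. [instance data] -/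
def u8 (r : ℝ) : ℝ := 1 / (4 * (1 + r ^ 2))

/-- The FORCE-BALANCE pressure for uniform `B_z = 1`: `p = c²/(2(1+r²)²) − c²/8 + c²/400` with `c² = 1/16`, i.e.
`p = 1/(32(1+r²)²) − 1/128 + 1/6400` (the edge value `c²/400 > 0` keeps `p > 0` slightly beyond the plasma edge, as in the
`q₀ = 7/10` member). [instance data] -/
def p8 (r : ℝ) : ℝ := 1 / (32 * (1 + r ^ 2) ^ 2) - 1 / 128 + 1 / 6400

/-- MODEL M_RWM,8's plasma equilibrium as a `ScrewPinch.Profile`: `μ₀ = 1`, `B_θ = r/(4(1+r²))`, `B_z ≡ 1`,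
`p = 1/(32(1+r²)²) − 1/128 + 1/6400`. [instance data] -/
def P8 : ScrewPinch.Profile :=
  { μ₀ := 1, Bθ := fun r => r * u8 r, Bz := fun _ => 1, p := p8 }

/-- `μ₀ = 1`. [instance data] -/
@[simp] theorem P8_μ₀ : P8.μ₀ = 1 := rfl

/-- `B_z ≡ 1`. [instance data] -/
@[simp] theorem P8_Bz (r : ℝ) : P8.Bz r = 1 := rfl

/-- `B_θ(r) = r/(4(1+r²))`. [instance data] -/
theorem P8_Bθ (r : ℝ) : P8.Bθ r = r / (4 * (1 + r ^ 2)) := by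
  show r * u8 r = _
  rw [u8]
  ring

/-- `p(r) = 1/(32(1+r²)²) − 1/128 + 1/6400` (force balance). [instance data] -/
theorem P8_p (r : ℝ) : P8.p r = 1 / (32 * (1 + r ^ 2) ^ 2) - 1 / 128 + 1 / 6400 := rfl

/-- `q := rB_z/(R₀B_θ) = (4/5)(1 + r²)` for `r ≠ 0` (`R₀ = 5`): the safety-factor profile, `q₀ = 4/5`, `q_a = 8/5`.
[instance data] -/
theorem q_eq {r : ℝ} (hr : r ≠ 0) : r * P8.Bz r / (5 * P8.Bθ r) = 4 / 5 * (1 + r ^ 2) := by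
  have h1 : (1 : ℝ) + r ^ 2 ≠ 0 := by positivity
  rw [P8_Bz, P8_Bθ]
  field_simp

/-- `p > 0` on `[0, 1]` (indeed `p(1) = 1/6400 > 0` and `p` decreases). [instance data] -/
theorem p8_pos {r : ℝ} (h0 : 0 ≤ r) (h1 : r ≤ 1) : 0 < p8 r := by
  have hr2 : r ^ 2 ≤ 1 := by nlinarith
  have hD : 0 < (1 + r ^ 2) ^ 2 := by positivity
  have hD2 : (1 + r ^ 2) ^ 2 ≤ 4 := by nlinarith
  unfold p8
  have key : 1 / (4 : ℝ) ≤ 1 / (1 + r ^ 2) ^ 2 := one_div_le_one_div_of_le hD hD2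
  have e : (1 : ℝ) / (32 * (1 + r ^ 2) ^ 2) = (1 / 32) * (1 / (1 + r ^ 2) ^ 2) := by
    field_simp
  rw [e]
  nlinarith [key]

/-- Central beta `β₀ = 2μ₀p(0)/B_z(0)² = 2p(0) = 151/3200` (≈ 4.7 %). [instance data] -/
theorem central_beta : 2 * P8.p 0 = 151 / 3200 := by
  rw [P8_p]
  norm_num

/-- `p′(r) = −r/(8(1+r²)³)`. [instance data] -/
theorem hasDerivAt_p (r : ℝ) : HasDerivAt P8.p (-r / (8 * (1 + r ^ 2) ^ 3)) r := by
  have e : P8.p = fun s : ℝ => 1 / (32 * (1 + s ^ 2) ^ 2) - 1 / 128 + 1 / 6400 := funext P8_p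
  rw [e]
  have h1 : (0 : ℝ) < 1 + r ^ 2 := by positivity
  have hc : HasDerivAt (fun s : ℝ => 1 + s ^ 2) (2 * r) r := by simpa using (hasDerivAt_pow 2 r).const_add 1
  have hd : HasDerivAt (fun s : ℝ => 32 * (1 + s ^ 2) ^ 2) (32 * (2 * (1 + r ^ 2) * (2 * r))) r := by
    have := (hc.pow 2).const_mul 32
    exact this.congr_deriv (by push_cast; ring)
  have hq : HasDerivAt (fun s : ℝ => 1 / (32 * (1 + s ^ 2) ^ 2)) (-r / (8 * (1 + r ^ 2) ^ 3)) r := by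
    have := (hasDerivAt_const r (1 : ℝ)).div hd (by positivity)
    refine this.congr_deriv ?_
    field_simp
    ring
  exact (hq.sub_const (1 / 128 : ℝ)).add_const (1 / 6400 : ℝ)

/-- `deriv p = p′`. [instance data] -/
theorem deriv_p (r : ℝ) : deriv P8.p r = -r / (8 * (1 + r ^ 2) ^ 3) := (hasDerivAt_p r).deriv

/-- The pressure is `C¹`. [instance data] -/
theorem contDiff_p : ContDiff ℝ 1 P8.p := by
  rw [show P8.p = fun s : ℝ => 1 / (32 * (1 + s ^ 2) ^ 2) - 1 / 128 + 1 / 6400 from funext P8_p]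
  exact ((contDiff_const.div (by fun_prop) (fun x => by positivity)).sub contDiff_const).add contDiff_const

/-- **MODEL M_RWM,8 IS AN EXACT EQUILIBRIUM**: `d/dr (p + (B_θ² + B_z²)/(2μ₀)) + B_θ²/(μ₀r) = 0` on `(0, 1)` (the tree
predicate `ScrewPinch.Profile.IsRadialPressureBalance`). [cite: Schnack2009, Lect. 30 eq. (30.30)] [instance data] -/
theorem isRadialPressureBalance : P8.IsRadialPressureBalance 1 := by
  intro r hr
  have hr0 : (0 : ℝ) < r := hr.1
  have key : (fun s => P8.p s + (P8.Bθ s ^ 2 + P8.Bz s ^ 2) / (2 * P8.μ₀))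
      = fun s => 1 / (32 * (1 + s ^ 2)) + ((1 : ℝ) / 2 - 1 / 128 + 1 / 6400) := by
    funext s
    have h1 : (1 : ℝ) + s ^ 2 ≠ 0 := by positivity
    rw [P8_p, P8_Bθ, P8_Bz, P8_μ₀]
    field_simp
    ring
  rw [key]
  have h1 : (1 : ℝ) + r ^ 2 ≠ 0 := by positivity
  have hD : HasDerivAt (fun s : ℝ => 32 * (1 + s ^ 2)) (32 * (2 * r)) r := by
    have := ((hasDerivAt_pow 2 r).const_add 1).const_mul (32 : ℝ)
    simpa using this
  have hinv := ((hasDerivAt_const r (1 : ℝ)).div hD (by positivity)).add_const ((1 : ℝ) / 2 - 1 / 128 + 1 / 6400)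
  have e : (0 * (32 * (1 + r ^ 2)) - 1 * (32 * (2 * r))) / (32 * (1 + r ^ 2)) ^ 2
      = -(P8.Bθ r ^ 2) / (P8.μ₀ * r) := by
    rw [P8_Bθ, P8_μ₀]
    field_simp
    ring
  rw [← e]
  exact hinv

/-- `B_θ` is `C¹` on `ℝ`. [instance data] -/
theorem contDiff_Bθ : ContDiff ℝ 1 P8.Bθ := by
  rw [show P8.Bθ = fun r : ℝ => r / (4 * (1 + r ^ 2)) from funext P8_Bθ]
  exact ContDiff.div (by fun_prop) (by fun_prop) fun r => by positivity

/-- The regularity hypotheses of Newcomb's external-mode test for this profile on `(−b, b)`, any `b`. [instance data] -/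
theorem profile_regular (b : ℝ) :
    ContDiffOn ℝ 1 P8.Bθ (Ioo (-b) b) ∧ ContDiffOn ℝ 1 P8.Bz (Ioo (-b) b) ∧ ContDiffOn ℝ 1 P8.p (Ioo (-b) b) ∧
      P8.Bθ 0 = 0 := by
  refine ⟨contDiff_Bθ.contDiffOn, ?_, contDiff_p.contDiffOn, by rw [P8_Bθ]; simp⟩
  rw [show P8.Bz = fun _ => (1 : ℝ) from funext P8_Bz]; exact contDiffOn_const

end Kq08

end RwmFRS1

end Summit.Ventures.FusionMHD.Models

end
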